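import Summits.ResolutionOfSingularities.ResolutionOfSingularities.Theorems.FrobeniusLadderFInjectiveMacaulayficationDiagonalSqSpecimen
import Summits.ResolutionOfSingularities.ResolutionOfSingularities.Theorems.FrobeniusLadderFInjectiveMacaulayficationF108ClassRow
import Summits.ResolutionOfSingularities.ResolutionOfSingularities.Theorems.FrobeniusLadderFInjectiveMacaulayficationTwoTermFedder
import HarnessLib

/-!
# THE DIAGONAL DOUBLE-POINT FAMILY `z² + x^a + y^a + u^a + t^a` (`a` ODD, `a ≥ 5`): point floor LEGAL and NOT FULL (every admissible `p`, unconditional) and ★★ THE FIRST CONDITIONAL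
# CLASS ROW OVER AN INFINITE FAMILY × ALL ADMISSIBLE `p` — `diagonalRow_of_F108Consumable : F108Consumable k 5 → … → ⟨LEGAL, NOT FULL, CURED⟩`
# (crux `FInjectiveMacaulayfication` stmt-ResolutionOfSingularities-15315, chain w45a; res-L1-w45a-plan-1 RULING R22.10 (b); seat res-L1-w45a-stub-1 g13; sequel of ✓ `…DiagonalSqSpecimen`,
# ✓ `…F108ClassRow` (R22.9 alt-2′), ✓ `…TwoTermFedder` (R22.10 (a)); B9 (`a = 9`) is the data-discharged member, res-L1-w45a-stub-3ʼs TASK 2)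

[OURS · L1 W4.5a] Support file (`--supports stmt-ResolutionOfSingularities-15315 --as helper`); def-free; §1–§2 UNCONDITIONAL; §3 CONDITIONAL on the named OURS hypothesis
`F108ClassRow.F108Consumable k 5` (an `@[conjecture]` interface predicate, NOT a Literature fact, NOT in the kernel) carried as an explicit binder `hF`. Nothing of the crux is
proved; no unconditional census row is proved here. AI-written (AI review is weaker than expert review).

Letters: `X 0..X 3 = x,y,u,t`, `X 4 = z`, `f = X4² + X0^a + X1^a + X2^a + X3^a`, `v` = the origin; `a` odd, `a ≥ 5`; `(2 : k) ≠ 0`, `(a : k) ≠ 0` where stated.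
* §1 `theta` — the five point-blow-up chart identities `θᵢ f = Xᵢ²·gᵢ` with `g_x = z² + x^{a−2}(1 + y^a + u^a + t^a)`, …, `g_z = 1 + z^{a−2}(x^a + y^a + u^a + t^a)` (symbolic `a`:
  `a = c + 2`, `ring`), `g_not_mem_span_X`, `constantCoeff_g_zero`.
* §2 ★ `pointFloor_diagonal_input_legal` (`2, a ≠ 0` in `k`; ✓ `PointFloorLegalOfIsolated`) and ★ `pointFloor_diagonal_not_full` — for EVERY prime `p` with `a ≠ 0` in `k`: every
  blowing up of the point floor has a NON-FULL stalk over the closed point (✓ `TwoTermFedder.pointFloor_not_full_of_sqChart`, `b = a − 2 ≥ 3`: a p-UNIFORM negative certificate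
  for the whole family).
* §3 ★★ `diagonalRow_of_F108Consumable` — `F108Consumable k 5 →` (`k = k̄`, char `p`, `a` odd `≥ 5`, `2, a ≠ 0` in `k`) for every blowing up of `Spec 𝒪_{X,v}` along the point floor:
  LEGAL ∧ NOT FULL ∧ CURED — ONE term on ✓ `F108ClassRow.pointFloorRow_of_F108Consumable` with the specimen package ✓ `DiagonalSqSpecimen` (prime, convenient, weakly
  non-degenerate, `x̄ᵢ ≠ 0`, regular off `v`, `v` singular) and §1's elementary data.
[folklore mathematics, OURS as a certificate; cite: Fedder1983, Thm. 1.12; IshiiSingularities2018, Thm. 4.4.23; GortzWedhorn2020, Prop. 13.91 (2)]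
-/

-- single-problem summit: the doubled namespace component is forced
set_option linter.dupNamespace false

noncomputable section

namespace Summit.ResolutionOfSingularities.ResolutionOfSingularities.Theorems.FInjectiveMacaulayfication.DiagonalSqRowOfF108

open CategoryTheory CategoryTheory.Limits AlgebraicGeometry TopologicalSpace IsLocalRing MvPolynomial
open Literature.AlgebraicGeometry.Resolution
open Summit.ResolutionOfSingularities.ResolutionOfSingularities.Theorems.FInjectiveMacaulayfication
open SliceableCentre

variable (k : Type) [Field k]

/-! ## §1 The strict transforms of the point blow-up (symbolic `a ≥ 2`) -/

/-- ★ **The chart identities** `θᵢ f = Xᵢ² · gᵢ` (`a ≥ 2`). [folklore] -/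
theorem theta (a : ℕ) (ha2 : 2 ≤ a) (f : MvPolynomial (Fin 5) k) (hf : f = X 4 ^ 2 + X 0 ^ a + X 1 ^ a + X 2 ^ a + X 3 ^ a) :
    ∀ i : Fin 5, aeval (fun j : Fin 5 => if j = i then (X i : MvPolynomial (Fin 5) k) else X j * X i) f =
      X i ^ ((fun _ : Fin 5 => 2) i) * (![X 4 ^ 2 + X 0 ^ (a - 2) * (1 + X 1 ^ a + X 2 ^ a + X 3 ^ a),
        X 4 ^ 2 + X 1 ^ (a - 2) * (1 + X 0 ^ a + X 2 ^ a + X 3 ^ a),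
        X 4 ^ 2 + X 2 ^ (a - 2) * (1 + X 0 ^ a + X 1 ^ a + X 3 ^ a),
        X 4 ^ 2 + X 3 ^ (a - 2) * (1 + X 0 ^ a + X 1 ^ a + X 2 ^ a),
        1 + X 4 ^ (a - 2) * (X 0 ^ a + X 1 ^ a + X 2 ^ a + X 3 ^ a)] : Fin 5 → MvPolynomial (Fin 5) k) i := by
  intro i
  subst hf
  obtain ⟨c, rfl⟩ : ∃ c, a = c + 2 := ⟨a - 2, by omega⟩
  simp only [Nat.add_sub_cancel]
  fin_cases i <;> simp <;> ring

/-- `gᵢ ∉ (Xᵢ)` for every `i` (`a ≥ 3`): evaluate at `e_z` (`gᵢ = 1` there, `i ≤ 3`) resp. at `0` (`g_z(0) = 1`). [folklore] -/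
theorem g_not_mem_span_X (a : ℕ) (ha3 : 3 ≤ a) :
    ∀ i : Fin 5, (![X 4 ^ 2 + X 0 ^ (a - 2) * (1 + X 1 ^ a + X 2 ^ a + X 3 ^ a),
        X 4 ^ 2 + X 1 ^ (a - 2) * (1 + X 0 ^ a + X 2 ^ a + X 3 ^ a),
        X 4 ^ 2 + X 2 ^ (a - 2) * (1 + X 0 ^ a + X 1 ^ a + X 3 ^ a),
        X 4 ^ 2 + X 3 ^ (a - 2) * (1 + X 0 ^ a + X 1 ^ a + X 2 ^ a),
        1 + X 4 ^ (a - 2) * (X 0 ^ a + X 1 ^ a + X 2 ^ a + X 3 ^ a)] : Fin 5 → MvPolynomial (Fin 5) k) i ∉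
      Ideal.span {(X i : MvPolynomial (Fin 5) k)} := by
  have ha2 : a - 2 ≠ 0 := by omega
  have ha0 : a ≠ 0 := by omega
  intro i h
  rw [Ideal.mem_span_singleton] at h
  obtain ⟨c, hc⟩ := h
  fin_cases i
  · have := congrArg (MvPolynomial.eval (Pi.single 4 1 : Fin 5 → k)) hc; simp [zero_pow ha2] at this
  · have := congrArg (MvPolynomial.eval (Pi.single 4 1 : Fin 5 → k)) hc; simp [zero_pow ha2] at this
  · have := congrArg (MvPolynomial.eval (Pi.single 4 1 : Fin 5 → k)) hc; simp [zero_pow ha2] at this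
  · have := congrArg (MvPolynomial.eval (Pi.single 4 1 : Fin 5 → k)) hc; simp [zero_pow ha2] at this
  · have := congrArg (MvPolynomial.eval (0 : Fin 5 → k)) hc; simp [zero_pow ha0] at this

/-- `g_x(0) = 0` (`a ≥ 3`): the origin of the `x`-chart lies on the strict transform. [folklore] -/
theorem constantCoeff_g_zero (a : ℕ) (ha3 : 3 ≤ a) : constantCoeff ((![X 4 ^ 2 + X 0 ^ (a - 2) * (1 + X 1 ^ a + X 2 ^ a + X 3 ^ a),
        X 4 ^ 2 + X 1 ^ (a - 2) * (1 + X 0 ^ a + X 2 ^ a + X 3 ^ a),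
        X 4 ^ 2 + X 2 ^ (a - 2) * (1 + X 0 ^ a + X 1 ^ a + X 3 ^ a),
        X 4 ^ 2 + X 3 ^ (a - 2) * (1 + X 0 ^ a + X 1 ^ a + X 2 ^ a),
        1 + X 4 ^ (a - 2) * (X 0 ^ a + X 1 ^ a + X 2 ^ a + X 3 ^ a)] : Fin 5 → MvPolynomial (Fin 5) k) 0) = 0 := by
  have ha2 : a - 2 ≠ 0 := by omega
  simp [constantCoeff_X, zero_pow ha2]

/-! ## §2 Unconditional: the point floor is LEGAL and NOT FULL (every admissible `p`) -/

/-- ★ **THE POINT FLOOR OF THE DIAGONAL FAMILY IS A LEGAL INPUT** (`a` odd `≥ 5`; `2, a ≠ 0` in `k`). [folklore assembly; cite: GortzWedhorn2020, Prop. 13.91 (2)] -/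
theorem pointFloor_diagonal_input_legal (a : ℕ) (ha : Odd a) (ha5 : 5 ≤ a) (h2 : (2 : k) ≠ 0) (haK : ((a : ℕ) : k) ≠ 0) (f : MvPolynomial (Fin 5) k)
    (hf : f = X 4 ^ 2 + X 0 ^ a + X 1 ^ a + X 2 ^ a + X 3 ^ a)
    (v : Spec (.of (MvPolynomial (Fin 5) k ⧸ Ideal.span {f})))
    (hv : v.asIdeal = Ideal.span (Set.range (fun j : Fin 5 => Ideal.Quotient.mk (Ideal.span {f}) (X j))))
    (S' : Scheme.{0}) (g : S' ⟶ Spec ((Spec (.of (MvPolynomial (Fin 5) k ⧸ Ideal.span {f}))).presheaf.stalk v))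
    (hg : IsBlowup g ((affineBlowup.idealSheaf (Ideal.span (Set.range (fun j : Fin 5 => Ideal.Quotient.mk (Ideal.span {f}) (X j))))).comap ((Spec (.of (MvPolynomial (Fin 5) k ⧸ Ideal.span {f}))).fromSpecStalk v))) :
    ((affineBlowup.idealSheaf (Ideal.span (Set.range (fun j : Fin 5 => Ideal.Quotient.mk (Ideal.span {f}) (X j))))).comap ((Spec (.of (MvPolynomial (Fin 5) k ⧸ Ideal.span {f}))).fromSpecStalk v)) ≠ ⊥ ∧
    (((((affineBlowup.idealSheaf (Ideal.span (Set.range (fun j : Fin 5 => Ideal.Quotient.mk (Ideal.span {f}) (X j))))).comap ((Spec (.of (MvPolynomial (Fin 5) k ⧸ Ideal.span {f}))).fromSpecStalk v))).support :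
        Set (Spec ((Spec (.of (MvPolynomial (Fin 5) k ⧸ Ideal.span {f}))).presheaf.stalk v))) ⊆ (Scheme.regularLocus (Spec ((Spec (.of (MvPolynomial (Fin 5) k ⧸ Ideal.span {f}))).presheaf.stalk v)))ᶜ) ∧
    (∀ s : S', g.base s ≠ closedPoint ((Spec (.of (MvPolynomial (Fin 5) k ⧸ Ideal.span {f}))).presheaf.stalk v) → s ∈ Scheme.regularLocus S') ∧
    (∀ s : S', CMCl (S'.presheaf.stalk s)) := by
  have hreg : ∀ y : Spec (.of (MvPolynomial (Fin 5) k ⧸ Ideal.span {f})), y ⤳ v → y ≠ v →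
      y ∈ Scheme.regularLocus (Spec (.of (MvPolynomial (Fin 5) k ⧸ Ideal.span {f}))) := by
    intro y hy hne
    refine FermatCubicConeGerm.mem_regularLocus_Spec_of_isRegularLocalRing y (DiagonalSqSpecimen.regular_off_vertex k a h2 haK f hf y.asIdeal fun hle => hne ?_)
    have hyv : y.asIdeal ≤ v.asIdeal := (PrimeSpectrum.le_iff_specializes y v).mpr hy
    exact PrimeSpectrum.ext (le_antisymm hyv (hv ▸ hle))
  exact PointFloorLegalOfIsolated.pointFloor_input_legal k f (DiagonalSqSpecimen.prime_f k a ha haK f hf) (by norm_num) (fun _ : Fin 5 => 2) _ (theta k a (by omega) f hf)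
    (DiagonalSqSpecimen.f_not_mem_span_X k a (by omega) f hf) (g_not_mem_span_X k a (by omega)) v hv
    (DiagonalSqSpecimen.vertex_not_mem_regularLocus k a ha (by omega) haK f hf v hv) hreg S' g hg

/-- ★ **THE POINT FLOOR OF THE DIAGONAL FAMILY IS NOT FULL, FOR EVERY PRIME `p` WITH `a ≠ 0` IN `k`** (`a` odd `≥ 5`): for every blowing up along the point floor some stalk over
the closed point is NOT `FullCl p` — the `x`-chart strict transform is the double point `z² + x^{a−2}·(1 + y^a + u^a + t^a)`, `a − 2 ≥ 3` (✓ `TwoTermFedder.pointFloor_not_full_of_sqChart`).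
[OURS · p-uniform negative certificate; cite: Fedder1983, Thm. 1.12] -/
theorem pointFloor_diagonal_not_full (p : ℕ) [Fact p.Prime] [CharP k p] (a : ℕ) (ha : Odd a) (ha5 : 5 ≤ a) (haK : ((a : ℕ) : k) ≠ 0) (f : MvPolynomial (Fin 5) k)
    (hf : f = X 4 ^ 2 + X 0 ^ a + X 1 ^ a + X 2 ^ a + X 3 ^ a)
    (v : Spec (.of (MvPolynomial (Fin 5) k ⧸ Ideal.span {f})))
    (hv : v.asIdeal = Ideal.span (Set.range (fun j : Fin 5 => Ideal.Quotient.mk (Ideal.span {f}) (X j))))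
    (S' : Scheme.{0}) (g : S' ⟶ Spec ((Spec (.of (MvPolynomial (Fin 5) k ⧸ Ideal.span {f}))).presheaf.stalk v))
    (hg : IsBlowup g ((affineBlowup.idealSheaf (Ideal.span (Set.range (fun j : Fin 5 => Ideal.Quotient.mk (Ideal.span {f}) (X j))))).comap ((Spec (.of (MvPolynomial (Fin 5) k ⧸ Ideal.span {f}))).fromSpecStalk v))) :
    ∃ s : S', g.base s = closedPoint ((Spec (.of (MvPolynomial (Fin 5) k ⧸ Ideal.span {f}))).presheaf.stalk v) ∧ ¬ FullCl p (S'.presheaf.stalk s) :=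
  TwoTermFedder.pointFloor_not_full_of_sqChart k p f (DiagonalSqSpecimen.prime_f k a ha haK f hf) (fun _ : Fin 5 => 2) _ (theta k a (by omega) f hf)
    (DiagonalSqSpecimen.f_not_mem_span_X k a (by omega) f hf) (g_not_mem_span_X k a (by omega)) (DiagonalSqSpecimen.constantCoeff_f k a (by omega) f hf)
    0 4 0 (a - 2) (by omega) (1 + X 1 ^ a + X 2 ^ a + X 3 ^ a) (by simp) v hv S' g hg

/-! ## §3 ★★ The conditional class row over the whole family -/

/-- ★★ **THE DIAGONAL FAMILY CONDITIONAL ROW**: CONDITIONAL on the named OURS hypothesis `F108ClassRow.F108Consumable k 5`, for `k = k̄` of characteristic `p`, `a` odd `≥ 5` with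
`2 ≠ 0` and `a ≠ 0` in `k`, and EVERY blowing up `g : S′ → Spec 𝒪_{X,v}` of the germ of `X = V(z² + x^a + y^a + u^a + t^a)` at the origin along the point floor: (LEGAL) centre `≠ ⊥`,
supported in the non-regular locus, `S′` regular off the closed fibre, CM everywhere; (NOT FULL) some stalk over the closed point is not `FullCl p`; (CURED) there is `𝓚 ≠ ⊥` on `S′`
supported over the closed point all of whose blowings up are FULL everywhere. ONE term on ✓ `F108ClassRow.pointFloorRow_of_F108Consumable`. The member `a = 9` (B9) is discharged
by data unconditionally (res-L1-w45a-stub-3). [OURS · conditional class row; cite: IshiiSingularities2018, Thm. 4.4.23; Fedder1983, Thm. 1.12] -/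
theorem diagonalRow_of_F108Consumable (p : ℕ) [Fact p.Prime] [IsAlgClosed k] [CharP k p] (hF : F108ClassRow.F108Consumable k 5)
    (a : ℕ) (ha : Odd a) (ha5 : 5 ≤ a) (h2 : (2 : k) ≠ 0) (haK : ((a : ℕ) : k) ≠ 0) (f : MvPolynomial (Fin 5) k)
    (hf : f = X 4 ^ 2 + X 0 ^ a + X 1 ^ a + X 2 ^ a + X 3 ^ a)
    (v : Spec (.of (MvPolynomial (Fin 5) k ⧸ Ideal.span {f})))
    (hv : v.asIdeal = Ideal.span (Set.range (fun j : Fin 5 => Ideal.Quotient.mk (Ideal.span {f}) (X j))))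
    (S' : Scheme.{0}) (g : S' ⟶ Spec ((Spec (.of (MvPolynomial (Fin 5) k ⧸ Ideal.span {f}))).presheaf.stalk v))
    (hg : IsBlowup g ((affineBlowup.idealSheaf (Ideal.span (Set.range (fun j : Fin 5 => Ideal.Quotient.mk (Ideal.span {f}) (X j))))).comap ((Spec (.of (MvPolynomial (Fin 5) k ⧸ Ideal.span {f}))).fromSpecStalk v))) :
    (((affineBlowup.idealSheaf (Ideal.span (Set.range fun j : Fin 5 => Ideal.Quotient.mk (Ideal.span {f}) (X j)))).comap
        ((Spec (.of (MvPolynomial (Fin 5) k ⧸ Ideal.span {f}))).fromSpecStalk v)) ≠ ⊥ ∧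
      ((((affineBlowup.idealSheaf (Ideal.span (Set.range fun j : Fin 5 => Ideal.Quotient.mk (Ideal.span {f}) (X j)))).comap
        ((Spec (.of (MvPolynomial (Fin 5) k ⧸ Ideal.span {f}))).fromSpecStalk v)).support :
          Set (Spec ((Spec (.of (MvPolynomial (Fin 5) k ⧸ Ideal.span {f}))).presheaf.stalk v))) ⊆
        (Scheme.regularLocus (Spec ((Spec (.of (MvPolynomial (Fin 5) k ⧸ Ideal.span {f}))).presheaf.stalk v)))ᶜ) ∧
      (∀ s : S', g.base s ≠ closedPoint _ → s ∈ Scheme.regularLocus S') ∧ (∀ s : S', CMCl (S'.presheaf.stalk s))) ∧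
    (∃ s : S', g.base s = closedPoint _ ∧ ¬ FullCl p (S'.presheaf.stalk s)) ∧
    (∃ 𝓚 : S'.IdealSheafData, 𝓚 ≠ ⊥ ∧ (∀ s ∈ (𝓚.support : Set S'), g.base s = closedPoint _) ∧
      ∀ (S'' : Scheme.{0}) (π : S'' ⟶ S'), IsBlowup π 𝓚 → ∀ s : S'', FullCl p (S''.presheaf.stalk s)) :=
  F108ClassRow.pointFloorRow_of_F108Consumable k p hF (by norm_num) f (DiagonalSqSpecimen.prime_f k a ha haK f hf) (DiagonalSqSpecimen.convenient_f k a ha f hf)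
    (DiagonalSqSpecimen.weaklyNondegenerate_f k a haK f hf) (DiagonalSqSpecimen.mk_X_ne_zero k a ha haK f hf)
    (fun x hx => DiagonalSqSpecimen.regular_off_vertex k a h2 haK f hf x.asIdeal hx) (fun _ : Fin 5 => 2) _ (theta k a (by omega) f hf)
    (DiagonalSqSpecimen.f_not_mem_span_X k a (by omega) f hf) (g_not_mem_span_X k a (by omega)) (DiagonalSqSpecimen.constantCoeff_f k a (by omega) f hf)
    0 (constantCoeff_g_zero k a (by omega))
    (by simpa using TwoTermFedder.twoTerm_sq_pow_mem_frobeniusPower k p (Fact.out : p.Prime).two_le (4 : Fin 5) 0 (a - 2) (by omega) (1 + X 1 ^ a + X 2 ^ a + X 3 ^ a))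
    v hv (DiagonalSqSpecimen.vertex_not_mem_regularLocus k a ha (by omega) haK f hf v hv) S' g hg

end Summit.ResolutionOfSingularities.ResolutionOfSingularities.Theorems.FInjectiveMacaulayfication.DiagonalSqRowOfF108

end
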